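import Summits.RiemannHypothesis.RiemannHypothesis.Theorems.OddSectorOddOneSignedWindowsOddFormDomainPos
import Summits.RiemannHypothesis.RiemannHypothesis.Theorems.OddSectorOddOneSignedWindowsFiniteEnergy
import HarnessLib

/-!
# The weak Euler–Lagrange equation of an odd-sector ground state IN THE FORM DOMAIN
# (helper for crux `OddSector.OddOneSignedWindows`, item stmt-RiemannHypothesis-17778; RH-free)

Odd twin of `WeilWindowFlowWindowLipschitz.stub_eulerLagrange` (route WeilWindowFlow; Bombieri
2000, §4 Lemma 1, eq. (4.2) `λ f = L[f]`, Markov-decomposed sesquilinear form). For an odd-sector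
ground state `u` at the window `a` (`IsWeilOddGroundState a u`) and EVERY odd finite-energy window
direction `w` (`w ∈ L²`, `w = 0` a.e. off `[-a, a]`, `w(-x) = -w(x)` a.e., integrable archimedean
energy density `ρ D(w)`), the polarised closed form satisfies

  `P(u, w) + Σ_{log n < 2a} Λ(n) n^{-1/2} D_{log n}(u, w) + ∫₀^∞ ρ(t) D_t(u, w) dt − M_a⟨u, w⟩
     = ε_od(a) ⟨u, w⟩`                                  (`oddGroundState_eulerLagrange_formDomain`)

with `P(u, w) = 2(∫u ch)(∫w ch)⁻ − 2(∫u sh)(∫w sh)⁻`, `D_t(u, w) = ∫ (u(x+t) − u x)(w(x+t) − w x)⁻dx`.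
Unlike the weak equation along approximating test sequences
(`IsWeilOddGroundState.exists_eulerLagrange`, `…EulerLagrangeTransfer`), this form pairs `u` with
NON-SMOOTH odd directions: the BV theta vector `H_a = −Φ′𝟙_{[-a,a]}` of the Barta pairing
(`OddBartaFloor`), truncations and folds of `u` itself (origin-layer / theta-envelope lines).

## Proof

First variation in the odd form domain: the two inputs are (C1, odd) `odd_formDomainPos_ae` —
`(M_a + ε_od(a))‖f‖₂² ≤ P(f) + 𝓔_a(f)` for every a.e.-odd finite-energy `f` living on the window,
applied to the competitors `u + s w`, `s ∈ ℂ` (a.e. odd) — and (C2) `oddGroundState_finiteEnergy` —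
`P(u) + 𝓔_a(u) ≤ M_a + ε_od(a)`, `∫|u|² = 1`. The algebra (`q(u + s w) = q(u) + |s|²q(w) +
2Re(s̄ B(u, w))`, AM–GM for the polarised increments, stability of the finite-energy class under
`u + s w`, and the discriminant) is the private toolkit of the even twin, reproduced verbatim.

References: E. Bombieri, Rend. Mat. Acc. Lincei (9) 11 (2000), §4 Lemma 1 (4.2); M. Reed, B. Simon,
*Methods of Modern Mathematical Physics IV* (1978), §XIII.1.
-/

set_option linter.dupNamespace false

noncomputable section

open MeasureTheory Set Filter
open scoped Topology ENNReal NNReal ComplexConjugate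

namespace Summit.RiemannHypothesis.RiemannHypothesis.Theorems.OddSector

open Literature.NumberTheory.LFunctions

-- the toolkit below is adapted verbatim from the private lemmas of
-- Theorems/WeilWindowFlowWindowLipschitzStubEulerLagrange.lean (route WeilWindowFlow)

/-- The archimedean density `ρ` is measurable. -/
private theorem eL_measurable_weilArchDensity : Measurable weilArchDensity := by
  unfold weilArchDensity
  exact (Real.continuous_exp.comp (continuous_id.div_const 2)).measurable.div
    (continuous_const.mul Real.continuous_sinh).measurable

/-- The increment field `(t, x) ↦ v(x + t) − v(x)` of an a.e.-strongly measurable `v` is jointly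
a.e.-strongly measurable (the shear `(t, x) ↦ x + t` is quasi-measure-preserving). -/
private theorem eL_aesm_field {v : ℝ → ℂ} (hv : AEStronglyMeasurable v volume) :
    AEStronglyMeasurable (fun p : ℝ × ℝ ↦ v (p.2 + p.1) - v p.2)
      ((volume : Measure ℝ).prod (volume : Measure ℝ)) :=
  (hv.comp_quasiMeasurePreserving (quasiMeasurePreserving_add_swap volume volume)).sub
    (hv.comp_quasiMeasurePreserving Measure.quasiMeasurePreserving_snd)

/-- The polarised increment `t ↦ D_t(v, w) = ∫ (v(x+t) − v x) conj(w(x+t) − w x) dx` is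
a.e.-strongly measurable in `t` (Fubini measurability of a parametric Bochner integral). -/
private theorem eL_aesm_cross {v w : ℝ → ℂ} (hv : AEStronglyMeasurable v volume)
    (hw : AEStronglyMeasurable w volume) :
    AEStronglyMeasurable
      (fun t : ℝ ↦ ∫ x, (v (x + t) - v x) * conj (w (x + t) - w x)) volume :=
  ((eL_aesm_field hv).mul
    (Complex.continuous_conj.comp_aestronglyMeasurable (eL_aesm_field hw))).integral_prod_right'

/-- The increment form `t ↦ D_t(v) = weilIncrement v t` of an a.e.-strongly measurable `v` is
a.e.-strongly measurable in `t`. -/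
private theorem eL_aesm_weilIncrement {v : ℝ → ℂ} (hv : AEStronglyMeasurable v volume) :
    AEStronglyMeasurable (weilIncrement v) volume :=
  ((continuous_pow 2).comp_aestronglyMeasurable (eL_aesm_field hv).norm).integral_prod_right'

/-- The difference of a translate and the function is in `L²`. -/
private theorem eL_memLp_field {v : ℝ → ℂ} (hv : MemLp v 2) (t : ℝ) :
    MemLp (fun x ↦ v (x + t) - v x) 2 :=
  (hv.comp_measurePreserving (measurePreserving_add_right volume t)).sub hv

/-- **Expansion of the increment form**:
`D_t(v + s w) = D_t(v) + |s|² D_t(w) + 2 Re(s̄ D_t(v, w))`. -/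
private theorem eL_weilIncrement_add_mul {v w : ℝ → ℂ} (hv : MemLp v 2) (hw : MemLp w 2)
    (s : ℂ) (t : ℝ) :
    weilIncrement (fun x ↦ v x + s * w x) t =
      weilIncrement v t + Complex.normSq s * weilIncrement w t +
        2 * (conj s * ∫ x, (v (x + t) - v x) * conj (w (x + t) - w x)).re := by
  have e : ∀ x, v (x + t) + s * w (x + t) - (v x + s * w x) =
      (v (x + t) - v x) + s * (w (x + t) - w x) := fun x ↦ by ring
  unfold weilIncrement
  simp_rw [e]
  exact ConnesVanSuijlekom.integral_norm_sq_add_mul (eL_memLp_field hv t) (eL_memLp_field hw t) s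

/-- **AM–GM for the polarised increment**: `|D_t(v, w)| ≤ (D_t(v) + D_t(w))/2`. -/
private theorem eL_norm_cross_le {v w : ℝ → ℂ} (hv : MemLp v 2) (hw : MemLp w 2) (t : ℝ) :
    ‖∫ x, (v (x + t) - v x) * conj (w (x + t) - w x)‖ ≤
      (weilIncrement v t + weilIncrement w t) / 2 := by
  have hiv := integrable_weilIncrement_integrand hv t
  have hiw := integrable_weilIncrement_integrand hw t
  calc ‖∫ x, (v (x + t) - v x) * conj (w (x + t) - w x)‖
      ≤ ∫ x, (‖v (x + t) - v x‖ ^ 2 + ‖w (x + t) - w x‖ ^ 2) / 2 := by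
        refine norm_integral_le_of_norm_le ((hiv.add hiw).div_const 2)
          (Eventually.of_forall fun x ↦ ?_)
        rw [norm_mul, Complex.norm_conj]
        linarith [two_mul_le_add_sq ‖v (x + t) - v x‖ ‖w (x + t) - w x‖]
    _ = (weilIncrement v t + weilIncrement w t) / 2 := by
        rw [integral_div, integral_add hiv hiw]
        rfl

/-- **The finite-energy class is stable under `v + s w`**: if `v, w ∈ L²` have finite archimedean
energy then so does `v + s w` (`D_t(v + s w) ≤ (1 + |s|) D_t(v) + (|s|² + |s|) D_t(w)`). -/
private theorem eL_integrableOn_add_mul {v w : ℝ → ℂ} (hv : MemLp v 2) (hw : MemLp w 2) (s : ℂ)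
    (hfv : IntegrableOn (fun t ↦ weilArchDensity t * weilIncrement v t) (Ioi 0))
    (hfw : IntegrableOn (fun t ↦ weilArchDensity t * weilIncrement w t) (Ioi 0)) :
    IntegrableOn (fun t ↦ weilArchDensity t * weilIncrement (fun x ↦ v x + s * w x) t) (Ioi 0) := by
  have hvw : AEStronglyMeasurable (fun x ↦ v x + s * w x) volume := hv.1.add (hw.1.const_mul s)
  have hm : AEStronglyMeasurable
      (fun t ↦ weilArchDensity t * weilIncrement (fun x ↦ v x + s * w x) t)
      (volume.restrict (Ioi 0)) :=
    (eL_measurable_weilArchDensity.aestronglyMeasurable.mul (eL_aesm_weilIncrement hvw)).restrict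
  refine Integrable.mono'
    ((hfv.const_mul (1 + ‖s‖)).add (hfw.const_mul (Complex.normSq s + ‖s‖))) hm ?_
  refine (ae_restrict_iff' measurableSet_Ioi).2 (Eventually.of_forall fun t (ht : 0 < t) ↦ ?_)
  have hρ := (weilArchDensity_pos ht).le
  rw [Real.norm_of_nonneg (mul_nonneg hρ (weilIncrement_nonneg _ _)),
    eL_weilIncrement_add_mul hv hw s t]
  have hre : (conj s * ∫ x, (v (x + t) - v x) * conj (w (x + t) - w x)).re ≤
      ‖s‖ * ((weilIncrement v t + weilIncrement w t) / 2) := by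
    refine (Complex.re_le_norm _).trans ?_
    rw [norm_mul, Complex.norm_conj]
    exact mul_le_mul_of_nonneg_left (eL_norm_cross_le hv hw t) (norm_nonneg _)
  have h2 := mul_le_mul_of_nonneg_left hre hρ
  simp only [Pi.add_apply]
  nlinarith [h2, mul_nonneg hρ (weilIncrement_nonneg v t), mul_nonneg hρ (weilIncrement_nonneg w t),
    norm_nonneg s]

/-- **The polarised energy converges**: `t ↦ ρ(t) D_t(v, w)` is integrable on `(0, ∞)` when
`v, w ∈ L²` have finite archimedean energy (`|D_t(v,w)| ≤ (D_t(v) + D_t(w))/2`). -/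
private theorem eL_integrableOn_cross {v w : ℝ → ℂ} (hv : MemLp v 2) (hw : MemLp w 2)
    (hfv : IntegrableOn (fun t ↦ weilArchDensity t * weilIncrement v t) (Ioi 0))
    (hfw : IntegrableOn (fun t ↦ weilArchDensity t * weilIncrement w t) (Ioi 0)) :
    IntegrableOn (fun t ↦ (weilArchDensity t : ℂ) *
      ∫ x, (v (x + t) - v x) * conj (w (x + t) - w x)) (Ioi 0) := by
  have hm : AEStronglyMeasurable (fun t ↦ (weilArchDensity t : ℂ) *
      ∫ x, (v (x + t) - v x) * conj (w (x + t) - w x)) (volume.restrict (Ioi 0)) :=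
    ((Complex.continuous_ofReal.measurable.comp
      eL_measurable_weilArchDensity).aestronglyMeasurable.mul (eL_aesm_cross hv.1 hw.1)).restrict
  refine Integrable.mono' ((hfv.add hfw).div_const 2) hm ?_
  refine (ae_restrict_iff' measurableSet_Ioi).2 (Eventually.of_forall fun t (ht : 0 < t) ↦ ?_)
  rw [norm_mul, Complex.norm_real, Real.norm_of_nonneg (weilArchDensity_pos ht).le]
  have := mul_le_mul_of_nonneg_left (eL_norm_cross_le hv hw t) (weilArchDensity_pos ht).le
  simp only [Pi.add_apply]
  linarith

/-- An `L²` function vanishing a.e. off `[-a, a]` is integrable against every continuous weight. -/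
private theorem eL_integrable_mul_continuous {v : ℝ → ℂ} {a : ℝ} (hv : MemLp v 2)
    (hv0 : ∀ᵐ x : ℝ, x ∉ Icc (-a) a → v x = 0) {φ : ℝ → ℂ} (hφ : Continuous φ) :
    Integrable fun x ↦ v x * φ x :=
  (IntegrableOn.mul_continuousOn ((hv.restrict (Icc (-a) a)).integrable one_le_two)
    hφ.continuousOn isCompact_Icc).integrable_of_ae_notMem_eq_zero
      (hv0.mono fun x hx hxs ↦ by simp [hx hxs])

/-- `|α + s β|² = |α|² + |s|² |β|² + 2 Re(s̄ α β̄)`. -/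
private theorem eL_norm_add_mul_sq (α β s : ℂ) :
    ‖α + s * β‖ ^ 2 = ‖α‖ ^ 2 + Complex.normSq s * ‖β‖ ^ 2 + 2 * (conj s * (α * conj β)).re := by
  rw [← Complex.normSq_eq_norm_sq, ← Complex.normSq_eq_norm_sq, ← Complex.normSq_eq_norm_sq,
    Complex.normSq_add, Complex.normSq_mul, map_mul]
  rw [show α * (conj s * conj β) = conj s * (α * conj β) by ring]

/-- Linearity of the weighted integrals: `∫ (v + s w) φ = ∫ v φ + s ∫ w φ`. -/
private theorem eL_integral_add_mul_mul {v w φ : ℝ → ℂ} (s : ℂ)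
    (hv : Integrable fun x ↦ v x * φ x) (hw : Integrable fun x ↦ w x * φ x) :
    ∫ x, (v x + s * w x) * φ x = (∫ x, v x * φ x) + s * ∫ x, w x * φ x := by
  have : ∀ x, (v x + s * w x) * φ x = v x * φ x + s * (w x * φ x) := fun x ↦ by ring
  simp_rw [this]
  rw [integral_add hv (hw.const_mul s), integral_const_mul]

/-- **Expansion of the pole form**: `P(v + s w) = P(v) + |s|² P(w) + 2 Re(s̄ P(v, w))` with the
polarised pole form `P(v, w) = 2 (∫ v ch)(∫ w ch)⁻ − 2 (∫ v sh)(∫ w sh)⁻`. -/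
private theorem eL_weilPoleForm_add_mul {v w : ℝ → ℂ} (s : ℂ)
    (hvc : Integrable fun x ↦ v x * (Real.cosh (x / 2) : ℂ))
    (hwc : Integrable fun x ↦ w x * (Real.cosh (x / 2) : ℂ))
    (hvs : Integrable fun x ↦ v x * (Real.sinh (x / 2) : ℂ))
    (hws : Integrable fun x ↦ w x * (Real.sinh (x / 2) : ℂ)) :
    weilPoleForm (fun x ↦ v x + s * w x) =
      weilPoleForm v + Complex.normSq s * weilPoleForm w +
        2 * (conj s *
          (2 * (∫ x, v x * (Real.cosh (x / 2) : ℂ)) * conj (∫ x, w x * (Real.cosh (x / 2) : ℂ)) -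
            2 * (∫ x, v x * (Real.sinh (x / 2) : ℂ)) *
              conj (∫ x, w x * (Real.sinh (x / 2) : ℂ)))).re := by
  have key : ∀ A B C D : ℂ, (conj s * (2 * A * conj B - 2 * C * conj D)).re =
      2 * (conj s * (A * conj B)).re - 2 * (conj s * (C * conj D)).re := by
    intro A B C D
    rw [show conj s * (2 * A * conj B - 2 * C * conj D) = ((2 : ℝ) : ℂ) * (conj s * (A * conj B)) -
      ((2 : ℝ) : ℂ) * (conj s * (C * conj D)) by push_cast; ring, Complex.sub_re,
      Complex.re_ofReal_mul, Complex.re_ofReal_mul]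
  unfold weilPoleForm
  rw [eL_integral_add_mul_mul s hvc hwc, eL_integral_add_mul_mul s hvs hws, eL_norm_add_mul_sq,
    eL_norm_add_mul_sq, key]
  ring

/-- **Expansion of the Dirichlet energy**:
`𝓔_a(v + s w) = 𝓔_a(v) + |s|² 𝓔_a(w) + 2 Re(s̄ 𝓔_a(v, w))`, with the polarised energy
`𝓔_a(v, w) = Σ_{log n < 2a} Λ(n) n^{-1/2} D_{log n}(v, w) + ∫₀^∞ ρ(t) D_t(v, w) dt`. -/
private theorem eL_weilDirichletEnergy_add_mul {v w : ℝ → ℂ} (a : ℝ) (s : ℂ) (hv : MemLp v 2)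
    (hw : MemLp w 2) (hfv : IntegrableOn (fun t ↦ weilArchDensity t * weilIncrement v t) (Ioi 0))
    (hfw : IntegrableOn (fun t ↦ weilArchDensity t * weilIncrement w t) (Ioi 0)) :
    weilDirichletEnergy a (fun x ↦ v x + s * w x) =
      weilDirichletEnergy a v + Complex.normSq s * weilDirichletEnergy a w +
        2 * (conj s *
          ((∑ n ∈ weilPrimeIndex a,
              (((ArithmeticFunction.vonMangoldt n : ℝ) / Real.sqrt n : ℝ) : ℂ) *
                ∫ x, (v (x + Real.log n) - v x) * conj (w (x + Real.log n) - w x)) +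
            ∫ t in Ioi (0 : ℝ), (weilArchDensity t : ℂ) *
              ∫ x, (v (x + t) - v x) * conj (w (x + t) - w x))).re := by
  -- scalar bookkeeping `r (D₁ + |s|² D₂ + 2 Re(s̄ X)) = r D₁ + |s|² (r D₂) + 2 Re(s̄ (r X))`
  have hsc : ∀ (r D₁ D₂ : ℝ) (X : ℂ), r * (D₁ + Complex.normSq s * D₂ + 2 * (conj s * X).re) =
      r * D₁ + Complex.normSq s * (r * D₂) + 2 * (conj s * ((r : ℂ) * X)).re := by
    intro r D₁ D₂ X
    rw [show conj s * ((r : ℂ) * X) = (r : ℂ) * (conj s * X) by ring, Complex.re_ofReal_mul]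
    ring
  have hcross := eL_integrableOn_cross hv hw hfv hfw
  have hre : Integrable (fun t ↦ 2 * (conj s * ((weilArchDensity t : ℂ) *
      ∫ x, (v (x + t) - v x) * conj (w (x + t) - w x))).re) (volume.restrict (Ioi 0)) := by
    simpa only [RCLike.re_to_complex] using ((hcross.const_mul (conj s)).re).const_mul 2
  have hI1 : Integrable (fun t ↦ weilArchDensity t * weilIncrement v t +
      Complex.normSq s * (weilArchDensity t * weilIncrement w t)) (volume.restrict (Ioi 0)) :=
    hfv.add (hfw.const_mul _)
  have key := integral_re (hcross.const_mul (conj s))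
  simp only [RCLike.re_to_complex, integral_const_mul] at key
  unfold weilDirichletEnergy
  simp_rw [eL_weilIncrement_add_mul hv hw s, hsc]
  rw [integral_add hI1 hre, integral_add hfv (hfw.const_mul _), integral_const_mul,
    integral_const_mul, key, Finset.sum_add_distrib, Finset.sum_add_distrib, ← Finset.mul_sum,
    ← Finset.mul_sum, ← Complex.re_sum, ← Finset.mul_sum, mul_add (conj s), Complex.add_re]
  ring

/-- **Second-order expansion of the shifted Markov form** `q(f) = P(f) + 𝓔_a(f) − K ∫|f|²` along
`v + s w` (`s ∈ ℂ`): `q(v + s w) = q(v) + |s|² q(w) + 2 Re(s̄ B(v, w))`, `B` the polarised form. -/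
private theorem eL_expansion {v w : ℝ → ℂ} {a : ℝ} (K : ℝ) (s : ℂ) (hv : MemLp v 2)
    (hw : MemLp w 2) (hv0 : ∀ᵐ x : ℝ, x ∉ Icc (-a) a → v x = 0)
    (hw0 : ∀ᵐ x : ℝ, x ∉ Icc (-a) a → w x = 0)
    (hfv : IntegrableOn (fun t ↦ weilArchDensity t * weilIncrement v t) (Ioi 0))
    (hfw : IntegrableOn (fun t ↦ weilArchDensity t * weilIncrement w t) (Ioi 0)) :
    weilPoleForm (fun x ↦ v x + s * w x) + weilDirichletEnergy a (fun x ↦ v x + s * w x) -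
        K * ∫ x, ‖v x + s * w x‖ ^ 2 =
      (weilPoleForm v + weilDirichletEnergy a v - K * ∫ x, ‖v x‖ ^ 2) +
        Complex.normSq s * (weilPoleForm w + weilDirichletEnergy a w - K * ∫ x, ‖w x‖ ^ 2) +
        2 * (conj s *
          (2 * (∫ x, v x * (Real.cosh (x / 2) : ℂ)) * conj (∫ x, w x * (Real.cosh (x / 2) : ℂ)) -
            2 * (∫ x, v x * (Real.sinh (x / 2) : ℂ)) *
              conj (∫ x, w x * (Real.sinh (x / 2) : ℂ)) +
            (∑ n ∈ weilPrimeIndex a,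
              (((ArithmeticFunction.vonMangoldt n : ℝ) / Real.sqrt n : ℝ) : ℂ) *
                ∫ x, (v (x + Real.log n) - v x) * conj (w (x + Real.log n) - w x)) +
            (∫ t in Ioi (0 : ℝ), (weilArchDensity t : ℂ) *
              ∫ x, (v (x + t) - v x) * conj (w (x + t) - w x)) -
            (K : ℂ) * ∫ x, v x * conj (w x))).re := by
  rw [eL_weilPoleForm_add_mul s (eL_integrable_mul_continuous hv hv0 (by fun_prop))
      (eL_integrable_mul_continuous hw hw0 (by fun_prop))
      (eL_integrable_mul_continuous hv hv0 (by fun_prop))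
      (eL_integrable_mul_continuous hw hw0 (by fun_prop)),
    eL_weilDirichletEnergy_add_mul a s hv hw hfv hfw,
    ConnesVanSuijlekom.integral_norm_sq_add_mul hv hw s]
  set CP : ℂ := 2 * (∫ x, v x * (Real.cosh (x / 2) : ℂ)) * conj (∫ x, w x * (Real.cosh (x / 2) : ℂ)) -
    2 * (∫ x, v x * (Real.sinh (x / 2) : ℂ)) * conj (∫ x, w x * (Real.sinh (x / 2) : ℂ))
  set CS : ℂ := ∑ n ∈ weilPrimeIndex a,
    (((ArithmeticFunction.vonMangoldt n : ℝ) / Real.sqrt n : ℝ) : ℂ) *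
      ∫ x, (v (x + Real.log n) - v x) * conj (w (x + Real.log n) - w x)
  set CI : ℂ := ∫ t in Ioi (0 : ℝ), (weilArchDensity t : ℂ) *
    ∫ x, (v (x + t) - v x) * conj (w (x + t) - w x)
  set CN : ℂ := ∫ x, v x * conj (w x)
  rw [show conj s * (CP + CS + CI - (K : ℂ) * CN) =
      conj s * CP + conj s * (CS + CI) - (K : ℂ) * (conj s * CN) by ring, Complex.sub_re,
    Complex.add_re, Complex.re_ofReal_mul]
  ring

/-- A real quadratic `2 b t + d t² ≥ 0` for all real `t` forces `b = 0` (discriminant). -/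
private theorem eL_quad {b d : ℝ} (h : ∀ t : ℝ, 0 ≤ 2 * b * t + d * t ^ 2) : b = 0 := by
  have hd := discrim_le_zero fun t ↦ show 0 ≤ d * (t * t) + 2 * b * t + 0 by nlinarith [h t]
  unfold discrim at hd
  exact pow_eq_zero_iff two_ne_zero |>.1 (le_antisymm (by nlinarith) (sq_nonneg b))

/-- **The variational lemma.** If `c ≤ 0` and `0 ≤ c + |s|² d + 2 Re(s̄ B)` for every `s ∈ ℂ`
then `B = 0` (real `s` kills `Re B`, imaginary `s` kills `Im B`). -/
private theorem eL_variation {c d : ℝ} {B : ℂ} (hc : c ≤ 0)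
    (h : ∀ s : ℂ, 0 ≤ c + Complex.normSq s * d + 2 * (conj s * B).re) : B = 0 := by
  have hre : B.re = 0 := by
    refine eL_quad (d := d) fun t ↦ ?_
    have h1 := h t
    rw [Complex.normSq_ofReal, Complex.conj_ofReal, Complex.re_ofReal_mul] at h1
    nlinarith [h1]
  have him : B.im = 0 := by
    refine eL_quad (d := d) fun t ↦ ?_
    have h1 := h (Complex.I * t)
    have e1 : Complex.normSq (Complex.I * t) = t * t := by simp [Complex.normSq_mul]
    have e2 : (conj (Complex.I * (t : ℂ)) * B).re = t * B.im := by simp [Complex.mul_re]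
    rw [e1, e2] at h1
    nlinarith [h1]
  exact Complex.ext hre him

/-- **Weak Euler–Lagrange equation of an odd-sector ground state in the form domain** (registered
sub-goal `oddGroundState_eulerLagrange_formDomain` of item stmt-RiemannHypothesis-17778): for an
odd-sector ground state `u` at the window `a` and every `w ∈ L²` vanishing a.e. off `[-a, a]`, odd
a.e., with integrable archimedean energy density, the polarised closed form equals `ε_od(a)⟨u, w⟩`.
[cite: Bombieri2000Weil, §4 Lemma 1 eq. (4.2)] -/
theorem oddGroundState_eulerLagrange_formDomain :
    ∀ (a : ℝ) (u : ℝ → ℂ), IsWeilOddGroundState a u →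
      ∀ w : ℝ → ℂ, MemLp w 2 → (∀ᵐ x : ℝ, x ∉ Icc (-a) a → w x = 0) →
        (∀ᵐ x : ℝ, w (-x) = -w x) →
        IntegrableOn (fun t ↦ weilArchDensity t * weilIncrement w t) (Ioi 0) →
        2 * (∫ x, u x * (Real.cosh (x / 2) : ℂ)) * (starRingEnd ℂ) (∫ x, w x * (Real.cosh (x / 2) : ℂ))
          - 2 * (∫ x, u x * (Real.sinh (x / 2) : ℂ)) * (starRingEnd ℂ) (∫ x, w x * (Real.sinh (x / 2) : ℂ))
          + (∑ n ∈ weilPrimeIndex a, (((ArithmeticFunction.vonMangoldt n : ℝ) / Real.sqrt n : ℝ) : ℂ) *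
              ∫ x, (u (x + Real.log n) - u x) * (starRingEnd ℂ) (w (x + Real.log n) - w x))
          + (∫ t in Ioi (0 : ℝ), (weilArchDensity t : ℂ) *
              ∫ x, (u (x + t) - u x) * (starRingEnd ℂ) (w (x + t) - w x))
          - (weilMarkovConstant a : ℂ) * ∫ x, u x * (starRingEnd ℂ) (w x)
        = (weilOddGroundEnergy a : ℂ) * ∫ x, u x * (starRingEnd ℂ) (w x) := by
  intro a u hu w hw hw0 hwo hfw
  obtain ⟨hfu, hqu'⟩ := oddGroundState_finiteEnergy a u hu
  have hU : MemLp u 2 := hu.memLp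
  have hu0 := hu.ae_eq_zero_of_notMem
  have huo := hu.ae_neg
  have hun := hu.integral_norm_sq
  have hqu : weilPoleForm u + weilDirichletEnergy a u ≤
      (weilMarkovConstant a + weilOddGroundEnergy a) * ∫ x, ‖u x‖ ^ 2 := by
    rw [hun, mul_one]; exact hqu'
  -- `B(u, w) = 0` by the first variation of `q` at the ground state
  have hBz : 2 * (∫ x, u x * (Real.cosh (x / 2) : ℂ)) * conj (∫ x, w x * (Real.cosh (x / 2) : ℂ)) -
      2 * (∫ x, u x * (Real.sinh (x / 2) : ℂ)) * conj (∫ x, w x * (Real.sinh (x / 2) : ℂ)) +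
      (∑ n ∈ weilPrimeIndex a,
        (((ArithmeticFunction.vonMangoldt n : ℝ) / Real.sqrt n : ℝ) : ℂ) *
          ∫ x, (u (x + Real.log n) - u x) * conj (w (x + Real.log n) - w x)) +
      (∫ t in Ioi (0 : ℝ), (weilArchDensity t : ℂ) *
        ∫ x, (u (x + t) - u x) * conj (w (x + t) - w x)) -
      ((weilMarkovConstant a + weilOddGroundEnergy a : ℝ) : ℂ) * ∫ x, u x * conj (w x) = 0 := by
    refine eL_variation
      (c := weilPoleForm u + weilDirichletEnergy a u -
        (weilMarkovConstant a + weilOddGroundEnergy a) * ∫ x, ‖u x‖ ^ 2)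
      (d := weilPoleForm w + weilDirichletEnergy a w -
        (weilMarkovConstant a + weilOddGroundEnergy a) * ∫ x, ‖w x‖ ^ 2)
      (by linarith) fun s ↦ ?_
    have hmem : MemLp (fun x ↦ u x + s * w x) 2 := hU.add (hw.const_mul s)
    have hzero : ∀ᵐ x : ℝ, x ∉ Icc (-a) a → u x + s * w x = 0 := by
      filter_upwards [hu0, hw0] with x hux hwx hx
      rw [hux hx, hwx hx, mul_zero, add_zero]
    have hodd : ∀ᵐ x : ℝ, u (-x) + s * w (-x) = -(u x + s * w x) := by
      filter_upwards [huo, hwo] with x hux hwx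
      rw [hux, hwx]; ring
    have h1 : (weilMarkovConstant a + weilOddGroundEnergy a) * ∫ x, ‖u x + s * w x‖ ^ 2 ≤
        weilPoleForm (fun x ↦ u x + s * w x) + weilDirichletEnergy a (fun x ↦ u x + s * w x) :=
      odd_formDomainPos_ae hu.pos hmem hzero hodd (eL_integrableOn_add_mul hU hw s hfu hfw)
    have h2 := eL_expansion (weilMarkovConstant a + weilOddGroundEnergy a) s hU hw hu0 hw0 hfu hfw
    linarith
  rw [Complex.ofReal_add] at hBz
  linear_combination hBz

end Summit.RiemannHypothesis.RiemannHypothesis.Theorems.OddSector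

end
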